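import Summits.BirchSwinnertonDyer.Rank1Residual.LW16.DescentReRouteShape
import HarnessLib

/-!
# LW16 re-route — RECORDS (pilot Pilot01): `BSD(E,p)` PER PAIR for 13 register cells now closed under the flag
# `LW16-Thm14-disputed-MN19-0.11`, re-derived WITHOUT Lawson–Wuthrich from a two-method `p`-isogeny descent

HONEST FRAMING (programme BSD-LIT2PART v1 §T3; cell `pub/bsd-litref/lw16`, seat `bsd-litref-lw16-pv`;
CONSUMERS.md c75348a6c4f5f01c): nothing here proves BSD; these are PER-PAIR theorems (OFFERS — referee A
books, nothing is booked here) that display, BY NAME, only the PUBLISHED named fact `hGZK`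
(Gross–Zagier–Kolyvagin, bsd.S17) and per-pair data; they replace, for the listed cells, the lane's T-LW
closure resting on `LawsonWuthrich2016.thm14_padicValNat_shaOrder_le*` at a REDUCIBLE `E[p]` (the case
Matar–Nekovář 2019 §0.10–0.11 call unproved/unjustified). Road = Miller–Stoll 2013 (explicit isogeny
descent), the one Lawson–Wuthrich §5 themselves use; kernel shapes `LW16.bsdp_rank{Zero,One}_of_ainvs_of_noPTorsionSha`
(p458836) over `Typed.bsdp_of_shaAn_unit_of_noPTorsion`. Per record: the literal Cremona model of curve 1
of the class (= the lane's curve; `Δ ≠ 0` kernel-decided), `hr` (analytic rank = Cremona rank = the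
lane's record), `hq`/`hv` (`#Ш_an = q`, `ord_p q = 0`: the lane's T-LW record certified `ord_p m = 0`,
bound `0`, i.e. `ord_p #Ш_an = 0`, on its two-engine Gross–Zagier value; Cremona `allbsd` S agrees), and
the ONE certificate line `hSha : Ш(E/ℚ)[p] = 0` whose EVIDENCE is the pilot row named in the docstring:
sha-2's `isogchi.gp` (2χ Kummer side, sha16 42175383589206a2; kit j257051) and `isogcft.gp` (class-field-theory
side, 0e36e3a0a15125b0; kit j257053) — cc-eng-2's B-3 bundle byte copies — AGREE on (d, χ(σ), s_hat, s_phi, m,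
EXCESS) for the printed kernel and EXCESS `= dim Ш(Ê)[φ̂] + dim Ш(E)[φ] = 0`, whence `Ш(E)[p] = 0`
(`Ш(E)[φ] → Ш(E)[p] → Ш(Ê)[φ̂]`); fold `lw16/eng/lw16desc-pilot-pv/PILOT-verdicts.tsv`. No torsion clause is
displayed: `m = r` on every row (no curve of the class has a rational `p`-point — the T-LW torsion check —
and `p ∤ #E(ℚ)_tors` by `allbsd`). Theorems only; no definition, no named fact, no `sorry`.

References: [MillerStoll2013] §§6–7, Thm. 9.1; [Miller2011LMS] §1, Def. 1.1; [SilvermanAEC2009] X.4;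
[Schaefer1996] Lemma 3.8 (local image sizes, the engine's target); [Cremona1997] Table 1 (`allcurves`,
`allbsd`); [LawsonWuthrich2016] §5; [MatarNekovar2019] §0.10–0.11.
-/

set_option autoImplicit false

noncomputable section

open scoped Classical

open WeierstrassCurve Literature.NumberTheory.EllipticCurves

namespace Summit.BirchSwinnertonDyer.Rank1Residual.LW16

/-- **`BSD(E,3)` for `176c1`** (class `176c`, `N = 176`, good (C6 cell, ψ odd: outside CGLS22 Thm F) at
`3`, `E[3]` REDUCIBLE, `r_an = 1`; register cell `(176c, 3)` LITERAL under
`LW16-Thm14-disputed-MN19-0.11`, lane T-LW record job j043667: Heegner field `D = -7`, index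
certificate of the R156-β C6 overlay, `ord_3 m = 0`, bound `0`). Cremona model `[0,-1,0,3,1]`;
`allbsd`: `#E(ℚ)_tors = 1`, `∏ c_ℓ = 2`, `#Ш_an = 1`. CERTIFICATE LINE `hSha : Ш(E/ℚ)[3] = 0` —
EVIDENCE: two-method 3-isogeny descent on this model, kernel `x + 1` (`[ℚ(T):ℚ] = 2`, `χ(σ) = 2`, `Ê
= [0, -1, 0, -77, 289]`, `α_φ = 1`): `s_hat = dim Sel^φ̂(Ê) = 0`, `s_phi = dim Sel^φ(E) = 1`, `m =
1`, **EXCESS = 0** on engine 1 (isogchi, j257051, 24ms) AND engine 2 (isogcft, j257053, 13ms),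
field-identical ⇒ `Ш(E)[3] = Ш(Ê)[3] = 0`. Displayed: PUBLISHED `hGZK`; per pair `hr`, `hq`/`hv`
(`ord_3 #Ш_an = 0`), `hSha`. NO Lawson–Wuthrich / Heegner / torsion / image binder. Per pair; OFFER
(the desk books); nothing else changes.
[cite: MillerStoll2013, §§6–7 and Thm. 9.1] [cite: Miller2011LMS, §1 and Def. 1.1]
[cite: Cremona1997, Table 1 (Cremona label 176c1)] -/
theorem bsdp3_isodesc_176c1 (hGZK : rank_eq_analyticRank_of_analyticRank_le_one)
    (W : WeierstrassCurve ℚ) (hWm : W = ⟨0, -1, 0, 3, 1⟩) (hr : W.analyticRank = 1)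
    {q : ℚ} (hq : shaAn W = (q : ℂ)) (hv : padicValRat 3 q = 0)
    (hSha : ∀ x : W.sha, (3 : ℤ) • x = 0 → x = 0) : BSDp W 3 := by
  subst hWm
  exact bsdp_rankOne_of_ainvs_of_noPTorsionSha hGZK 0 (-1) 0 3 1 3 (by decide +kernel) hr hq hv hSha

/-- **`BSD(E,3)` for `242a1`** (class `242a`, `N = 242`, good ordinary anomalous (a_p ≡ 1 mod p) at `3`,
`E[3]` REDUCIBLE, `r_an = 1`; register cell `(242a, 3)` LITERAL under
`LW16-Thm14-disputed-MN19-0.11`, lane T-LW record job j043667: Heegner field `D = -7`, `m = 8`, `4ρ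
= 64`, `ord_3 m = 0`, bound `0`). Cremona model `[1,0,0,3,1]`; `allbsd`: `#E(ℚ)_tors = 1`, `∏ c_ℓ =
4`, `#Ш_an = 1`. CERTIFICATE LINE `hSha : Ш(E/ℚ)[3] = 0` — EVIDENCE: two-method 3-isogeny descent on
this model, kernel `x + 1` (`[ℚ(T):ℚ] = 2`, `χ(σ) = 2`, `Ê = [1, 0, 0, -52, 144]`, `α_φ = 1`):
`s_hat = dim Sel^φ̂(Ê) = 0`, `s_phi = dim Sel^φ(E) = 1`, `m = 1`, **EXCESS = 0** on engine 1
(isogchi, j257051, 29ms) AND engine 2 (isogcft, j257053, 45ms), field-identical ⇒ `Ш(E)[3] = Ш(Ê)[3]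
= 0`. Displayed: PUBLISHED `hGZK`; per pair `hr`, `hq`/`hv` (`ord_3 #Ш_an = 0`), `hSha`. NO
Lawson–Wuthrich / Heegner / torsion / image binder. Per pair; OFFER (the desk books); nothing else
changes.
[cite: MillerStoll2013, §§6–7 and Thm. 9.1] [cite: Miller2011LMS, §1 and Def. 1.1]
[cite: Cremona1997, Table 1 (Cremona label 242a1)] -/
theorem bsdp3_isodesc_242a1 (hGZK : rank_eq_analyticRank_of_analyticRank_le_one)
    (W : WeierstrassCurve ℚ) (hWm : W = ⟨1, 0, 0, 3, 1⟩) (hr : W.analyticRank = 1)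
    {q : ℚ} (hq : shaAn W = (q : ℂ)) (hv : padicValRat 3 q = 0)
    (hSha : ∀ x : W.sha, (3 : ℤ) • x = 0 → x = 0) : BSDp W 3 := by
  subst hWm
  exact bsdp_rankOne_of_ainvs_of_noPTorsionSha hGZK 1 0 0 3 1 3 (by decide +kernel) hr hq hv hSha

/-- **`BSD(E,3)` for `432e1`** (class `432e`, `N = 432`, additive at `3`, `E[3]` REDUCIBLE, `r_an = 0`;
register cell `(432e, 3)` LITERAL under `LW16-Thm14-disputed-MN19-0.11`, lane T-LW record job
j043667: Heegner field `D = -23`, `m = 4`, `4ρ = 16`, `ord_3 m = 0`, bound `0`). Cremona model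
`[0,0,0,-51,-142]`; `allbsd`: `#E(ℚ)_tors = 1`, `∏ c_ℓ = 2`, `#Ш_an = 1`. CERTIFICATE LINE `hSha :
Ш(E/ℚ)[3] = 0` — EVIDENCE: two-method 3-isogeny descent on this model, kernel `x + 3` (`[ℚ(T):ℚ] =
2`, `χ(σ) = 2`, `Ê = [0, 0, 0, 189, -702]`, `α_φ = 1`): `s_hat = dim Sel^φ̂(Ê) = 0`, `s_phi = dim
Sel^φ(E) = 0`, `m = 0`, **EXCESS = 0** on engine 1 (isogchi, j257051, 23ms) AND engine 2 (isogcft,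
j257053, 27ms), field-identical ⇒ `Ш(E)[3] = Ш(Ê)[3] = 0`. Displayed: PUBLISHED `hGZK`; per pair
`hr`, `hq`/`hv` (`ord_3 #Ш_an = 0`), `hSha`. NO Lawson–Wuthrich / Heegner / torsion / image binder.
Per pair; OFFER (the desk books); nothing else changes.
[cite: MillerStoll2013, §§6–7 and Thm. 9.1] [cite: Miller2011LMS, §1 and Def. 1.1]
[cite: Cremona1997, Table 1 (Cremona label 432e1)] -/
theorem bsdp3_isodesc_432e1 (hGZK : rank_eq_analyticRank_of_analyticRank_le_one)
    (W : WeierstrassCurve ℚ) (hWm : W = ⟨0, 0, 0, -51, -142⟩) (hr : W.analyticRank = 0)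
    {q : ℚ} (hq : shaAn W = (q : ℂ)) (hv : padicValRat 3 q = 0)
    (hSha : ∀ x : W.sha, (3 : ℤ) • x = 0 → x = 0) : BSDp W 3 := by
  subst hWm
  exact bsdp_rankZero_of_ainvs_of_noPTorsionSha hGZK 0 0 0 (-51) (-142) 3 (by decide +kernel) hr hq hv hSha

/-- **`BSD(E,3)` for `432f1`** (class `432f`, `N = 432`, additive at `3`, `E[3]` REDUCIBLE, `r_an = 1`;
register cell `(432f, 3)` LITERAL under `LW16-Thm14-disputed-MN19-0.11`, lane T-LW record job
j043667: Heegner field `D = -23`, `m = 8`, `4ρ = 64`, `ord_3 m = 0`, bound `0`). Cremona model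
`[0,0,0,21,26]`; `allbsd`: `#E(ℚ)_tors = 1`, `∏ c_ℓ = 4`, `#Ш_an = 1`. CERTIFICATE LINE `hSha :
Ш(E/ℚ)[3] = 0` — EVIDENCE: two-method 3-isogeny descent on this model, kernel `x - 1` (`[ℚ(T):ℚ] =
2`, `χ(σ) = 2`, `Ê = [0, 0, 0, -219, -1654]`, `α_φ = 1`): `s_hat = dim Sel^φ̂(Ê) = 1`, `s_phi = dim
Sel^φ(E) = 0`, `m = 1`, **EXCESS = 0** on engine 1 (isogchi, j257051, 24ms) AND engine 2 (isogcft,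
j257053, 11ms), field-identical ⇒ `Ш(E)[3] = Ш(Ê)[3] = 0`. Displayed: PUBLISHED `hGZK`; per pair
`hr`, `hq`/`hv` (`ord_3 #Ш_an = 0`), `hSha`. NO Lawson–Wuthrich / Heegner / torsion / image binder.
Per pair; OFFER (the desk books); nothing else changes.
[cite: MillerStoll2013, §§6–7 and Thm. 9.1] [cite: Miller2011LMS, §1 and Def. 1.1]
[cite: Cremona1997, Table 1 (Cremona label 432f1)] -/
theorem bsdp3_isodesc_432f1 (hGZK : rank_eq_analyticRank_of_analyticRank_le_one)
    (W : WeierstrassCurve ℚ) (hWm : W = ⟨0, 0, 0, 21, 26⟩) (hr : W.analyticRank = 1)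
    {q : ℚ} (hq : shaAn W = (q : ℂ)) (hv : padicValRat 3 q = 0)
    (hSha : ∀ x : W.sha, (3 : ℤ) • x = 0 → x = 0) : BSDp W 3 := by
  subst hWm
  exact bsdp_rankOne_of_ainvs_of_noPTorsionSha hGZK 0 0 0 21 26 3 (by decide +kernel) hr hq hv hSha

/-- **`BSD(E,3)` for `528g1`** (class `528g`, `N = 528`, non-split multiplicative at `3`, `E[3]`
REDUCIBLE, `r_an = 1`; register cell `(528g, 3)` LITERAL under `LW16-Thm14-disputed-MN19-0.11`, lane
T-LW record job j043667: Heegner field `D = -95`, `m = 8`, `4ρ = 64`, `ord_3 m = 0`, bound `0`).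
Cremona model `[0,-1,0,-88,-272]`; `allbsd`: `#E(ℚ)_tors = 2`, `∏ c_ℓ = 4`, `#Ш_an = 1`. CERTIFICATE
LINE `hSha : Ш(E/ℚ)[3] = 0` — EVIDENCE: two-method 3-isogeny descent on this model, kernel `x + 8`
(`[ℚ(T):ℚ] = 2`, `χ(σ) = 2`, `Ê = [0, -1, 0, -1288, 18160]`, `α_φ = 1`): `s_hat = dim Sel^φ̂(Ê) =
0`, `s_phi = dim Sel^φ(E) = 1`, `m = 1`, **EXCESS = 0** on engine 1 (isogchi, j257051, 30ms) AND
engine 2 (isogcft, j257053, 9ms), field-identical ⇒ `Ш(E)[3] = Ш(Ê)[3] = 0`. Displayed: PUBLISHED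
`hGZK`; per pair `hr`, `hq`/`hv` (`ord_3 #Ш_an = 0`), `hSha`. NO Lawson–Wuthrich / Heegner / torsion
/ image binder. Per pair; OFFER (the desk books); nothing else changes.
[cite: MillerStoll2013, §§6–7 and Thm. 9.1] [cite: Miller2011LMS, §1 and Def. 1.1]
[cite: Cremona1997, Table 1 (Cremona label 528g1)] -/
theorem bsdp3_isodesc_528g1 (hGZK : rank_eq_analyticRank_of_analyticRank_le_one)
    (W : WeierstrassCurve ℚ) (hWm : W = ⟨0, -1, 0, -88, -272⟩) (hr : W.analyticRank = 1)
    {q : ℚ} (hq : shaAn W = (q : ℂ)) (hv : padicValRat 3 q = 0)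
    (hSha : ∀ x : W.sha, (3 : ℤ) • x = 0 → x = 0) : BSDp W 3 := by
  subst hWm
  exact bsdp_rankOne_of_ainvs_of_noPTorsionSha hGZK 0 (-1) 0 (-88) (-272) 3 (by decide +kernel) hr hq hv hSha

/-- **`BSD(E,5)` for `50a1`** (class `50a`, `N = 50`, additive at `5`, `E[5]` REDUCIBLE, `r_an = 0`;
register cell `(50a, 5)` LITERAL under `LW16-Thm14-disputed-MN19-0.11`, lane T-LW record job
j043667: Heegner field `D = -31`, `m = 2`, `4ρ = 4`, `ord_5 m = 0`, bound `0`). Cremona model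
`[1,0,1,-1,-2]`; `allbsd`: `#E(ℚ)_tors = 3`, `∏ c_ℓ = 3`, `#Ш_an = 1`. CERTIFICATE LINE `hSha :
Ш(E/ℚ)[5] = 0` — EVIDENCE: two-method 5-isogeny descent on this model, kernel `x^2 + x - 1`
(`[ℚ(T):ℚ] = 4`, `χ(σ) = 3`, `Ê = [1, 0, 1, -76, 298]`, `α_φ = 1`): `s_hat = dim Sel^φ̂(Ê) = 0`,
`s_phi = dim Sel^φ(E) = 0`, `m = 0`, **EXCESS = 0** on engine 1 (isogchi, j257051, 75ms) AND engine
2 (isogcft, j257053, 13ms), field-identical ⇒ `Ш(E)[5] = Ш(Ê)[5] = 0`. Displayed: PUBLISHED `hGZK`;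
per pair `hr`, `hq`/`hv` (`ord_5 #Ш_an = 0`), `hSha`. NO Lawson–Wuthrich / Heegner / torsion / image
binder. Per pair; OFFER (the desk books); nothing else changes.
[cite: MillerStoll2013, §§6–7 and Thm. 9.1] [cite: Miller2011LMS, §1 and Def. 1.1]
[cite: Cremona1997, Table 1 (Cremona label 50a1)] -/
theorem bsdp5_isodesc_50a1 (hGZK : rank_eq_analyticRank_of_analyticRank_le_one)
    (W : WeierstrassCurve ℚ) (hWm : W = ⟨1, 0, 1, -1, -2⟩) (hr : W.analyticRank = 0)
    {q : ℚ} (hq : shaAn W = (q : ℂ)) (hv : padicValRat 5 q = 0)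
    (hSha : ∀ x : W.sha, (5 : ℤ) • x = 0 → x = 0) : BSDp W 5 := by
  subst hWm
  haveI : Fact (Nat.Prime 5) := ⟨by norm_num⟩
  exact bsdp_rankZero_of_ainvs_of_noPTorsionSha hGZK 1 0 1 (-1) (-2) 5 (by decide +kernel) hr hq hv hSha

/-- **`BSD(E,5)` for `225e1`** (class `225e`, `N = 225`, additive at `5`, `E[5]` REDUCIBLE, `r_an = 1`;
register cell `(225e, 5)` LITERAL under `LW16-Thm14-disputed-MN19-0.11`, lane T-LW record job
j043667: Heegner field `D = -11`, `m = 24`, `4ρ = 576`, `ord_5 m = 0`, bound `0`). Cremona model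
`[0,0,1,-75,256]`; `allbsd`: `#E(ℚ)_tors = 1`, `∏ c_ℓ = 12`, `#Ш_an = 1`. CERTIFICATE LINE `hSha :
Ш(E/ℚ)[5] = 0` — EVIDENCE: two-method 5-isogeny descent on this model, kernel `x^2 - 5*x - 5`
(`[ℚ(T):ℚ] = 4`, `χ(σ) = 3`, `Ê = [0, 0, 1, 375, -12344]`, `α_φ = 1`): `s_hat = dim Sel^φ̂(Ê) = 1`,
`s_phi = dim Sel^φ(E) = 0`, `m = 1`, **EXCESS = 0** on engine 1 (isogchi, j257051, 99ms) AND engine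
2 (isogcft, j257053, 14ms), field-identical ⇒ `Ш(E)[5] = Ш(Ê)[5] = 0`. Displayed: PUBLISHED `hGZK`;
per pair `hr`, `hq`/`hv` (`ord_5 #Ш_an = 0`), `hSha`. NO Lawson–Wuthrich / Heegner / torsion / image
binder. Per pair; OFFER (the desk books); nothing else changes.
[cite: MillerStoll2013, §§6–7 and Thm. 9.1] [cite: Miller2011LMS, §1 and Def. 1.1]
[cite: Cremona1997, Table 1 (Cremona label 225e1)] -/
theorem bsdp5_isodesc_225e1 (hGZK : rank_eq_analyticRank_of_analyticRank_le_one)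
    (W : WeierstrassCurve ℚ) (hWm : W = ⟨0, 0, 1, -75, 256⟩) (hr : W.analyticRank = 1)
    {q : ℚ} (hq : shaAn W = (q : ℂ)) (hv : padicValRat 5 q = 0)
    (hSha : ∀ x : W.sha, (5 : ℤ) • x = 0 → x = 0) : BSDp W 5 := by
  subst hWm
  haveI : Fact (Nat.Prime 5) := ⟨by norm_num⟩
  exact bsdp_rankOne_of_ainvs_of_noPTorsionSha hGZK 0 0 1 (-75) 256 5 (by decide +kernel) hr hq hv hSha

/-- **`BSD(E,5)` for `304a1`** (class `304a`, `N = 304`, good ordinary anomalous (a_p ≡ 1 mod p) at `5`,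
`E[5]` REDUCIBLE, `r_an = 1`; register cell `(304a, 5)` LITERAL under
`LW16-Thm14-disputed-MN19-0.11`, lane T-LW record job j043667: Heegner field `D = -71`, `m = 8`, `4ρ
= 64`, `ord_5 m = 0`, bound `0`). Cremona model `[0,1,0,0,-76]`; `allbsd`: `#E(ℚ)_tors = 1`, `∏ c_ℓ
= 4`, `#Ш_an = 1`. CERTIFICATE LINE `hSha : Ш(E/ℚ)[5] = 0` — EVIDENCE: two-method 5-isogeny descent
on this model, kernel `x^2 + 4*x - 12` (`[ℚ(T):ℚ] = 2`, `χ(σ) = 4`, `Ê = [0, 1, 0, -1120, 15604]`,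
`α_φ = 1`): `s_hat = dim Sel^φ̂(Ê) = 0`, `s_phi = dim Sel^φ(E) = 1`, `m = 1`, **EXCESS = 0** on
engine 1 (isogchi, j257051, 140ms) AND engine 2 (isogcft, j257053, 37ms), field-identical ⇒ `Ш(E)[5]
= Ш(Ê)[5] = 0`. Displayed: PUBLISHED `hGZK`; per pair `hr`, `hq`/`hv` (`ord_5 #Ш_an = 0`), `hSha`.
NO Lawson–Wuthrich / Heegner / torsion / image binder. Per pair; OFFER (the desk books); nothing
else changes.
[cite: MillerStoll2013, §§6–7 and Thm. 9.1] [cite: Miller2011LMS, §1 and Def. 1.1]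
[cite: Cremona1997, Table 1 (Cremona label 304a1)] -/
theorem bsdp5_isodesc_304a1 (hGZK : rank_eq_analyticRank_of_analyticRank_le_one)
    (W : WeierstrassCurve ℚ) (hWm : W = ⟨0, 1, 0, 0, -76⟩) (hr : W.analyticRank = 1)
    {q : ℚ} (hq : shaAn W = (q : ℂ)) (hv : padicValRat 5 q = 0)
    (hSha : ∀ x : W.sha, (5 : ℤ) • x = 0 → x = 0) : BSDp W 5 := by
  subst hWm
  haveI : Fact (Nat.Prime 5) := ⟨by norm_num⟩
  exact bsdp_rankOne_of_ainvs_of_noPTorsionSha hGZK 0 1 0 0 (-76) 5 (by decide +kernel) hr hq hv hSha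

/-- **`BSD(E,5)` for `338e1`** (class `338e`, `N = 338`, good (C6 cell, ψ odd: outside CGLS22 Thm F) at
`5`, `E[5]` REDUCIBLE, `r_an = 1`; register cell `(338e, 5)` LITERAL under
`LW16-Thm14-disputed-MN19-0.11`, lane T-LW record job j043667: Heegner field `D = -23`, index
certificate of the R156-β C6 overlay, `ord_5 m = 0`, bound `0`). Cremona model `[1,1,1,3,-5]`;
`allbsd`: `#E(ℚ)_tors = 1`, `∏ c_ℓ = 6`, `#Ш_an = 1`. CERTIFICATE LINE `hSha : Ш(E/ℚ)[5] = 0` —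
EVIDENCE: two-method 5-isogeny descent on this model, kernel `x^2 + 3*x - 1` (`[ℚ(T):ℚ] = 4`, `χ(σ)
= 3`, `Ê = [1, 1, 1, -322, 2127]`, `α_φ = 1`): `s_hat = dim Sel^φ̂(Ê) = 0`, `s_phi = dim Sel^φ(E) =
1`, `m = 1`, **EXCESS = 0** on engine 1 (isogchi, j257051, 191ms) AND engine 2 (isogcft, j257053,
32ms), field-identical ⇒ `Ш(E)[5] = Ш(Ê)[5] = 0`. Displayed: PUBLISHED `hGZK`; per pair `hr`,
`hq`/`hv` (`ord_5 #Ш_an = 0`), `hSha`. NO Lawson–Wuthrich / Heegner / torsion / image binder. Per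
pair; OFFER (the desk books); nothing else changes.
[cite: MillerStoll2013, §§6–7 and Thm. 9.1] [cite: Miller2011LMS, §1 and Def. 1.1]
[cite: Cremona1997, Table 1 (Cremona label 338e1)] -/
theorem bsdp5_isodesc_338e1 (hGZK : rank_eq_analyticRank_of_analyticRank_le_one)
    (W : WeierstrassCurve ℚ) (hWm : W = ⟨1, 1, 1, 3, -5⟩) (hr : W.analyticRank = 1)
    {q : ℚ} (hq : shaAn W = (q : ℂ)) (hv : padicValRat 5 q = 0)
    (hSha : ∀ x : W.sha, (5 : ℤ) • x = 0 → x = 0) : BSDp W 5 := by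
  subst hWm
  haveI : Fact (Nat.Prime 5) := ⟨by norm_num⟩
  exact bsdp_rankOne_of_ainvs_of_noPTorsionSha hGZK 1 1 1 3 (-5) 5 (by decide +kernel) hr hq hv hSha

/-- **`BSD(E,5)` for `1395c1`** (class `1395c`, `N = 1395`, non-split multiplicative at `5`, `E[5]`
REDUCIBLE, `r_an = 1`; register cell `(1395c, 5)` LITERAL under `LW16-Thm14-disputed-MN19-0.11`,
lane T-LW record job j043667: Heegner field `D = -11`, `m = 2`, `4ρ = 4`, `ord_5 m = 0`, bound `0`).
Cremona model `[0,0,1,87,-257]`; `allbsd`: `#E(ℚ)_tors = 1`, `∏ c_ℓ = 1`, `#Ш_an = 1`. CERTIFICATE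
LINE `hSha : Ш(E/ℚ)[5] = 0` — EVIDENCE: two-method 5-isogeny descent on this model, kernel `x^2 +
13*x - 14` (`[ℚ(T):ℚ] = 2`, `χ(σ) = 4`, `Ê = [0, 0, 1, -7563, 253633]`, `α_φ = 1`): `s_hat = dim
Sel^φ̂(Ê) = 0`, `s_phi = dim Sel^φ(E) = 1`, `m = 1`, **EXCESS = 0** on engine 1 (isogchi, j257051,
194ms) AND engine 2 (isogcft, j257053, 78ms), field-identical ⇒ `Ш(E)[5] = Ш(Ê)[5] = 0`. Displayed:
PUBLISHED `hGZK`; per pair `hr`, `hq`/`hv` (`ord_5 #Ш_an = 0`), `hSha`. NO Lawson–Wuthrich / Heegner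
/ torsion / image binder. Per pair; OFFER (the desk books); nothing else changes.
[cite: MillerStoll2013, §§6–7 and Thm. 9.1] [cite: Miller2011LMS, §1 and Def. 1.1]
[cite: Cremona1997, Table 1 (Cremona label 1395c1)] -/
theorem bsdp5_isodesc_1395c1 (hGZK : rank_eq_analyticRank_of_analyticRank_le_one)
    (W : WeierstrassCurve ℚ) (hWm : W = ⟨0, 0, 1, 87, -257⟩) (hr : W.analyticRank = 1)
    {q : ℚ} (hq : shaAn W = (q : ℂ)) (hv : padicValRat 5 q = 0)
    (hSha : ∀ x : W.sha, (5 : ℤ) • x = 0 → x = 0) : BSDp W 5 := by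
  subst hWm
  haveI : Fact (Nat.Prime 5) := ⟨by norm_num⟩
  exact bsdp_rankOne_of_ainvs_of_noPTorsionSha hGZK 0 0 1 87 (-257) 5 (by decide +kernel) hr hq hv hSha

/-- **`BSD(E,7)` for `294a1`** (class `294a`, `N = 294`, additive at `7`, `E[7]` REDUCIBLE, `r_an = 0`;
register cell `(294a, 7)` LITERAL under `LW16-Thm14-disputed-MN19-0.11`, lane T-LW record job
j043667: Heegner field `D = -47`, `m = 2`, `4ρ = 4`, `ord_7 m = 0`, bound `0`). Cremona model
`[1,1,1,-50,293]`; `allbsd`: `#E(ℚ)_tors = 1`, `∏ c_ℓ = 1`, `#Ш_an = 1`. CERTIFICATE LINE `hSha :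
Ш(E/ℚ)[7] = 0` — EVIDENCE: two-method 7-isogeny descent on this model, kernel `x^3 - 11*x^2 - 74*x +
281` (`[ℚ(T):ℚ] = 3`, `χ(σ) = 2`, `Ê = [1, 1, 1, -6910, -232261]`, `α_φ = 1`): `s_hat = dim
Sel^φ̂(Ê) = 0`, `s_phi = dim Sel^φ(E) = 0`, `m = 0`, **EXCESS = 0** on engine 1 (isogchi, j257051,
164ms) AND engine 2 (isogcft, j257053, 19ms), field-identical ⇒ `Ш(E)[7] = Ш(Ê)[7] = 0`. Displayed:
PUBLISHED `hGZK`; per pair `hr`, `hq`/`hv` (`ord_7 #Ш_an = 0`), `hSha`. NO Lawson–Wuthrich / Heegner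
/ torsion / image binder. Per pair; OFFER (the desk books); nothing else changes.
[cite: MillerStoll2013, §§6–7 and Thm. 9.1] [cite: Miller2011LMS, §1 and Def. 1.1]
[cite: Cremona1997, Table 1 (Cremona label 294a1)] -/
theorem bsdp7_isodesc_294a1 (hGZK : rank_eq_analyticRank_of_analyticRank_le_one)
    (W : WeierstrassCurve ℚ) (hWm : W = ⟨1, 1, 1, -50, 293⟩) (hr : W.analyticRank = 0)
    {q : ℚ} (hq : shaAn W = (q : ℂ)) (hv : padicValRat 7 q = 0)
    (hSha : ∀ x : W.sha, (7 : ℤ) • x = 0 → x = 0) : BSDp W 7 := by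
  subst hWm
  haveI : Fact (Nat.Prime 7) := ⟨by norm_num⟩
  exact bsdp_rankZero_of_ainvs_of_noPTorsionSha hGZK 1 1 1 (-50) 293 7 (by decide +kernel) hr hq hv hSha

/-- **`BSD(E,7)` for `405d1`** (class `405d`, `N = 405`, good (C6 cell, ψ odd: outside CGLS22 Thm F) at
`7`, `E[7]` REDUCIBLE, `r_an = 1`; register cell `(405d, 7)` LITERAL under
`LW16-Thm14-disputed-MN19-0.11`, lane T-LW record job j043667: Heegner field `D = -11`, index
certificate of the R156-β C6 overlay, `ord_7 m = 0`, bound `0`). Cremona model `[1,-1,1,-2,-26]`;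
`allbsd`: `#E(ℚ)_tors = 1`, `∏ c_ℓ = 3`, `#Ш_an = 1`. CERTIFICATE LINE `hSha : Ш(E/ℚ)[7] = 0` —
EVIDENCE: two-method 7-isogeny descent on this model, kernel `x^3 + 6*x^2 - 15*x - 19` (`[ℚ(T):ℚ] =
6`, `χ(σ) = 3`, `Ê = [1, -1, 1, -2027, 35776]`, `α_φ = 1`): `s_hat = dim Sel^φ̂(Ê) = 0`, `s_phi =
dim Sel^φ(E) = 1`, `m = 1`, **EXCESS = 0** on engine 1 (isogchi, j257051, 564ms) AND engine 2
(isogcft, j257053, 60ms), field-identical ⇒ `Ш(E)[7] = Ш(Ê)[7] = 0`. Displayed: PUBLISHED `hGZK`;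
per pair `hr`, `hq`/`hv` (`ord_7 #Ш_an = 0`), `hSha`. NO Lawson–Wuthrich / Heegner / torsion / image
binder. Per pair; OFFER (the desk books); nothing else changes.
[cite: MillerStoll2013, §§6–7 and Thm. 9.1] [cite: Miller2011LMS, §1 and Def. 1.1]
[cite: Cremona1997, Table 1 (Cremona label 405d1)] -/
theorem bsdp7_isodesc_405d1 (hGZK : rank_eq_analyticRank_of_analyticRank_le_one)
    (W : WeierstrassCurve ℚ) (hWm : W = ⟨1, -1, 1, -2, -26⟩) (hr : W.analyticRank = 1)
    {q : ℚ} (hq : shaAn W = (q : ℂ)) (hv : padicValRat 7 q = 0)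
    (hSha : ∀ x : W.sha, (7 : ℤ) • x = 0 → x = 0) : BSDp W 7 := by
  subst hWm
  haveI : Fact (Nat.Prime 7) := ⟨by norm_num⟩
  exact bsdp_rankOne_of_ainvs_of_noPTorsionSha hGZK 1 (-1) 1 (-2) (-26) 7 (by decide +kernel) hr hq hv hSha

/-- **`BSD(E,7)` for `637a1`** (class `637a`, `N = 637`, additive at `7`, `E[7]` REDUCIBLE, `r_an = 1`;
register cell `(637a, 7)` LITERAL under `LW16-Thm14-disputed-MN19-0.11`, lane T-LW record job
j043667: Heegner field `D = -40`, `m = 4`, `4ρ = 16`, `ord_7 m = 0`, bound `0`). Cremona model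
`[1,-1,0,-107,454]`; `allbsd`: `#E(ℚ)_tors = 1`, `∏ c_ℓ = 1`, `#Ш_an = 1`. CERTIFICATE LINE `hSha :
Ш(E/ℚ)[7] = 0` — EVIDENCE: two-method 7-isogeny descent on this model, kernel `x^3 - 13*x^2 + 40*x +
13` (`[ℚ(T):ℚ] = 3`, `χ(σ) = 4`, `Ê = [1, -1, 0, 628, -17823]`, `α_φ = 1`): `s_hat = dim Sel^φ̂(Ê) =
1`, `s_phi = dim Sel^φ(E) = 0`, `m = 1`, **EXCESS = 0** on engine 1 (isogchi, j257051, 326ms) AND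
engine 2 (isogcft, j257053, 74ms), field-identical ⇒ `Ш(E)[7] = Ш(Ê)[7] = 0`. Displayed: PUBLISHED
`hGZK`; per pair `hr`, `hq`/`hv` (`ord_7 #Ш_an = 0`), `hSha`. NO Lawson–Wuthrich / Heegner / torsion
/ image binder. Per pair; OFFER (the desk books); nothing else changes.
[cite: MillerStoll2013, §§6–7 and Thm. 9.1] [cite: Miller2011LMS, §1 and Def. 1.1]
[cite: Cremona1997, Table 1 (Cremona label 637a1)] -/
theorem bsdp7_isodesc_637a1 (hGZK : rank_eq_analyticRank_of_analyticRank_le_one)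
    (W : WeierstrassCurve ℚ) (hWm : W = ⟨1, -1, 0, -107, 454⟩) (hr : W.analyticRank = 1)
    {q : ℚ} (hq : shaAn W = (q : ℂ)) (hv : padicValRat 7 q = 0)
    (hSha : ∀ x : W.sha, (7 : ℤ) • x = 0 → x = 0) : BSDp W 7 := by
  subst hWm
  haveI : Fact (Nat.Prime 7) := ⟨by norm_num⟩
  exact bsdp_rankOne_of_ainvs_of_noPTorsionSha hGZK 1 (-1) 0 (-107) 454 7 (by decide +kernel) hr hq hv hSha

end Summit.BirchSwinnertonDyer.Rank1Residual.LW16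

end
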